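import Summits.QuantumFields.YangMills.Theorems.SmallFieldWideningLargeFieldMassRefinementTailCondStab

/-!
# Route `SmallFieldWidening`, crux r3 `LargeFieldMassRefinementTail` (stmt-QuantumFields-22884), line `birth` v6 — `CondStab` IN BAŁABAN'S DENSITY CURRENCY: the
# conditional unit tail given a small sub-unit history IS the normalised large-plaquette part of the terminal restricted density, so the one-step hypothesis of
# `…CondStab` is a comparison of the restricted densities `T^{K+1}(1_S e^{−β_{K+1}A})` and `T^{K}(1_S e^{−β_K A})` of two consecutive runs on ONE local event
# (support file; width seat `ym-line-sfw-p2-w2` gen 17; the stub `stub_firstExitDeep`, the crux and rung R3 stay OPEN)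

WHAT THIS IS NOT.  No estimate of Bałaban's programme is proved; nothing bears on the Yang–Mills mass gap; rung R3 (`YM3TorusSU2`) is a RECORD rung.  This file is the
dictionary between the companion file's probabilistic one-step hypothesis `CondStab` and the objects the (α)/UV3 lane types (`T3RestrictedUnitDensity.resUnitDensity`,
Bałaban's renormalisation transformations `T`):

* §1 `gibbsK_real_histGood_one_eq` — `Gibbs_K(histGood K 1) = Z_K⁻¹·∫ ρ̂^{histGood K 1}_K du` (the companion identity at threshold `t ≤ 0`);
  ★ `cond_unitTop_eq_densityRatio` — for every run `K`, profile `θ`, threshold `t` and unit plaquette `p` (label `q`):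
  `Gibbs_K[ t ≤ |Ū^K(∂p) − 1|  |  histGood K 1 ] = (∫_{t ≤ |u(∂q)−1|} ρ̂^{histGood K 1}_K du) / (∫ ρ̂^{histGood K 1}_K du)` — the partition function cancels; the
  conditional unit tail in the pure small-field sector is an INTENSIVE ratio of two integrals of the SAME terminal restricted density.
* §2 ★ `largeFieldMassRefinementTail_of_densityStepFam` — crux r3 from the one-step comparison of these ratios for the refined families (the hypothesis of
  `largeFieldMassRefinementTail_of_condStabFam` rewritten through §1): for deep `d`, every label `q` and `K ≥ 2`,
  `[∫_{E_q} ρ̂^{S}_{K+1} / ∫ ρ̂^{S}_{K+1}] ≤ e^{ρ_K} · [∫_{E_q} ρ̂^{S}_K / ∫ ρ̂^{S}_K]`, `Σ_{2≤k<K} ρ_k ≤ R d` sub-Gaussian in `p(g_d)` — where the numerator run has one more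
  ultraviolet level, i.e. its density is one more application of Bałaban's `T` to a finer initial density.  This is [Balaban1985UV3] Thm 1's inductive step read on
  one local event with both extensive normalisations divided out; the (α) lane's NODE-O is its supplier.

References: T. Bałaban, Commun. Math. Phys. **102** (1985) 255–275 [Balaban1985UV3] ((2) p.256, (6)–(7) p.257, (41) p.266, (70)–(71) p.273); CMP **109** (1987) 249–301
[Balaban1987RG1] (Thm 1 p.259).
-/

noncomputable section

open MeasureTheory Filter Topology ProbabilityTheory
open Literature.MathematicalPhysics.QuantumFieldTheory.Balaban1983to89
open Literature.MathematicalPhysics.QuantumFieldTheory.Balaban1983to89.Missing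
open Literature.MathematicalPhysics.QuantumFieldTheory.Balaban1983to89.T3ContinuumYM3Torus
open Literature.MathematicalPhysics.QuantumFieldTheory.Balaban1983to89.T3UnitScaleTilt
open Literature.MathematicalPhysics.QuantumFieldTheory.Balaban1983to89.T3UnitLawDensityEML (ℰp measurableE_ℰp)
open Literature.MathematicalPhysics.QuantumFieldTheory.Balaban1983to89.T3LevelShift
open Literature.MathematicalPhysics.QuantumFieldTheory.Balaban1983to89.T3RestrictedUnitDensity
open Summit.QuantumFields.YangMills.Theorems.LargeFieldMassRefinementTailUnitTopDensity (gibbsK_real_unitTop_eq_integral_resUnitDensity)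
open Summit.QuantumFields.YangMills.Theorems.LargeFieldMassRefinementTailCondStab (largeFieldMassRefinementTail_of_condStabFam)

namespace Summit.QuantumFields.YangMills.Theorems.LargeFieldMassRefinementTailCondStabDensity

/-! ## §1 The conditional unit tail is a ratio of two integrals of the terminal restricted density -/

section Ratio

variable (F : T3Family) {γ : ℝ} (K : ℕ)

/-- **`Gibbs_K(histGood K 1) = Z_K⁻¹ ∫ ρ̂^{histGood K 1}_K`** (the companion identity at the trivial threshold `t = −1 ≤ 0 ≤ dist1`). [cite: Balaban1985UV3, (2) p.256 and (6)-(7) p.257] -/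
theorem gibbsK_real_histGood_one_eq (hγ : 0 ≤ γ) (θ : ℕ → ℝ) (p : Plaq (F.P K) K) :
    (gibbsK F ℰp γ K).real (histGood F ℰp θ K 1) =
      (partitionFn (G := Matrix.specialUnitaryGroup (Fin 2) ℂ) (F.P K) ((F.scheme ℰp γ).β K))⁻¹ *
        ∫ u, resUnitDensity F γ K (histGood F ℰp θ K 1) u ∂fieldMeasure (F.P 0) 0 (Matrix.specialUnitaryGroup (Fin 2) ℂ) := by
  have key := gibbsK_real_unitTop_eq_integral_resUnitDensity F K hγ θ (-1) p
  have hset : {U : GaugeField (F.P K) 0 (Matrix.specialUnitaryGroup (Fin 2) ℂ) | (∀ k, k < K →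
        PlaqSmall (θ (K - k)) (Averaging.iter (fun i => BlockAveraging.blockAvg (P := F.P K) (j := i) ℰp) k U)) ∧
        (-1 : ℝ) ≤ GaugeGroup.dist1 (GaugeField.plaqHol (Averaging.iter (fun i => BlockAveraging.blockAvg (P := F.P K) (j := i) ℰp) K U) p)} =
      histGood F ℰp θ K 1 := by
    ext U
    simp only [histGood, Set.mem_setOf_eq]
    constructor
    · rintro ⟨h, -⟩ j hj
      exact h j (by omega)
    · intro h
      have h0 := GaugeGroup.dist1_nonneg
        (GaugeField.plaqHol (Averaging.iter (fun i => BlockAveraging.blockAvg (P := F.P K) (j := i) ℰp) K U) p)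
      exact ⟨fun k hk => h k (by omega), by linarith⟩
  have hE : {u : GaugeField (F.P 0) 0 (Matrix.specialUnitaryGroup (Fin 2) ℂ) |
      (-1 : ℝ) ≤ GaugeGroup.dist1 (GaugeField.plaqHol u ((plaqShift (F.sitesPerDir_unit K)).symm p))} = Set.univ :=
    Set.eq_univ_of_forall fun u => by
      have h0 := GaugeGroup.dist1_nonneg (GaugeField.plaqHol u ((plaqShift (F.sitesPerDir_unit K)).symm p))
      simp only [Set.mem_setOf_eq]
      linarith
  rw [hset, hE, Measure.restrict_univ] at key
  exact key

/-- ★ **THE CONDITIONAL UNIT TAIL IS THE NORMALISED LARGE-PLAQUETTE PART OF THE TERMINAL RESTRICTED DENSITY**: for every run `K`, profile `θ`, threshold `t` and unit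
plaquette `p` (label `q = plaqShift⁻¹ p`), `Gibbs_K[ {t ≤ |Ū^K(∂p)−1|} | histGood K 1 ] = (∫_{t ≤ |u(∂q)−1|} ρ̂^{histGood K 1}_K du)/(∫ ρ̂^{histGood K 1}_K du)` — the partition function
cancels (if the history is Gibbs-null both sides are `0`). [cite: Balaban1985UV3, (2) p.256, (6)-(7) p.257 and (70)-(71) p.273] -/
theorem cond_unitTop_eq_densityRatio (hγ : 0 ≤ γ) (θ : ℕ → ℝ) (t : ℝ) (p : Plaq (F.P K) K) :
    (cond (gibbsK F ℰp γ K) (histGood F ℰp θ K 1)).real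
        {U | t ≤ GaugeGroup.dist1 (GaugeField.plaqHol
          (Averaging.iter (fun i => BlockAveraging.blockAvg (P := F.P K) (j := i) ℰp) K U) p)} =
      (∫ u in {u | t ≤ GaugeGroup.dist1 (GaugeField.plaqHol u ((plaqShift (F.sitesPerDir_unit K)).symm p))},
          resUnitDensity F γ K (histGood F ℰp θ K 1) u ∂fieldMeasure (F.P 0) 0 (Matrix.specialUnitaryGroup (Fin 2) ℂ)) /
        ∫ u, resUnitDensity F γ K (histGood F ℰp θ K 1) u ∂fieldMeasure (F.P 0) 0 (Matrix.specialUnitaryGroup (Fin 2) ℂ) := by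
  set S := histGood (G := Matrix.specialUnitaryGroup (Fin 2) ℂ) F ℰp θ K 1 with hSdef
  have hS : MeasurableSet S := measurableSet_histGood F ℰp measurableE_ℰp θ K 1
  set Z := partitionFn (G := Matrix.specialUnitaryGroup (Fin 2) ℂ) (F.P K) ((F.scheme ℰp γ).β K) with hZdef
  have hZ : 0 < Z := partitionFn_pos' _ (F.scheme_β_nonneg ℰp hγ K)
  -- joint mass and history mass in the density currency
  have hjoint := gibbsK_real_unitTop_eq_integral_resUnitDensity F K hγ θ t p
  have hhist := gibbsK_real_histGood_one_eq F K hγ θ p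
  rw [← hZdef] at hjoint hhist
  have hinter : S ∩ {U | t ≤ GaugeGroup.dist1 (GaugeField.plaqHol
        (Averaging.iter (fun i => BlockAveraging.blockAvg (P := F.P K) (j := i) ℰp) K U) p)} =
      {U | (∀ k, k < K → PlaqSmall (θ (K - k)) (Averaging.iter (fun i => BlockAveraging.blockAvg (P := F.P K) (j := i) ℰp) k U)) ∧
        t ≤ GaugeGroup.dist1 (GaugeField.plaqHol (Averaging.iter (fun i => BlockAveraging.blockAvg (P := F.P K) (j := i) ℰp) K U) p)} := by
    ext U
    simp only [hSdef, histGood, Set.mem_inter_iff, Set.mem_setOf_eq]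
    exact ⟨fun ⟨h1, h2⟩ => ⟨fun k hk => h1 k (by omega), h2⟩, fun ⟨h1, h2⟩ => ⟨fun j hj => h1 j (by omega), h2⟩⟩
  rw [measureReal_def, cond_apply hS, ENNReal.toReal_mul, ENNReal.toReal_inv, ← measureReal_def, ← measureReal_def, hinter, hjoint, hhist]
  -- `(Z⁻¹ a)⁻¹ (Z⁻¹ b) = b / a`
  set a := ∫ u, resUnitDensity F γ K S u ∂fieldMeasure (F.P 0) 0 (Matrix.specialUnitaryGroup (Fin 2) ℂ) with ha
  set b := ∫ u in {u | t ≤ GaugeGroup.dist1 (GaugeField.plaqHol u ((plaqShift (F.sitesPerDir_unit K)).symm p))},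
    resUnitDensity F γ K S u ∂fieldMeasure (F.P 0) 0 (Matrix.specialUnitaryGroup (Fin 2) ℂ) with hb
  by_cases ha0 : a = 0
  · rw [ha0]; simp
  · have hZ0 : Z ≠ 0 := hZ.ne'
    field_simp

end Ratio

/-! ## §2 Crux r3 from the one-step comparison of the density ratios -/

section Step

/-- ★ **CRUX r3 FROM THE ONE-STEP DENSITY COMPARISON `DensityStepFam`** — `CondStabFam` of the companion file with every conditional tail rewritten as the ratio
`∫_{E_q}ρ̂^S_K / ∫ρ̂^S_K` of §1 (refined families `F.refine d` at `γL^{-d}`, small sub-unit histories `S = histGood K 1`): if for every block size a profile exists such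
that every family at every coupling has, for deep `d`, every label `q` and every `K ≥ 2`, `ratio_{K+1}(q) ≤ e^{ρ_K}·ratio_K(q)` with accumulated slack sub-Gaussian in
`p(g_d)`, then `LargeFieldMassRefinementTail` (stmt-QuantumFields-22884) holds.  Conditional certificate; nothing about the mass gap.
[cite: Balaban1985UV3, (41) p.266 and (70)-(71) p.273; Balaban1987RG1, Thm 1 p.259] -/
theorem largeFieldMassRefinementTail_of_densityStepFam
    (hDS : ∀ L : ℕ, ∃ (b₀ p₀ : ℝ), 0 < b₀ ∧ 2 < p₀ ∧ ∀ (F : T3Family) (γ : ℝ), F.L = L → 0 < γ →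
      ∃ (n₁ : ℕ) (R : ℕ → ℝ),
        (∀ η : ℝ, 0 < η → ∃ A : ℝ, ∀ d : ℕ, n₁ ≤ d →
          R d ≤ A + η * B10.pFun b₀ p₀ (Real.sqrt (γ * ((F.L : ℝ)⁻¹) ^ d)) ^ 2) ∧
        ∀ d : ℕ, n₁ ≤ d → ∀ q : Plaq ((F.refine d).P 0) 0, ∃ ρ : ℕ → ℝ,
          (∀ K : ℕ, ∑ k ∈ Finset.Ico 2 K, ρ k ≤ R d) ∧
          ∀ K : ℕ, 2 ≤ K →
            (∫ u in {u | θBal F.L (γ * ((F.L : ℝ)⁻¹) ^ d) b₀ p₀ 0 ≤ GaugeGroup.dist1 (GaugeField.plaqHol u q)},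
                resUnitDensity (F.refine d) (γ * ((F.L : ℝ)⁻¹) ^ d) (K + 1)
                  (histGood (F.refine d) ℰp (θBal F.L (γ * ((F.L : ℝ)⁻¹) ^ d) b₀ p₀) (K + 1) 1) u
                ∂fieldMeasure ((F.refine d).P 0) 0 (Matrix.specialUnitaryGroup (Fin 2) ℂ)) /
              (∫ u, resUnitDensity (F.refine d) (γ * ((F.L : ℝ)⁻¹) ^ d) (K + 1)
                  (histGood (F.refine d) ℰp (θBal F.L (γ * ((F.L : ℝ)⁻¹) ^ d) b₀ p₀) (K + 1) 1) u
                ∂fieldMeasure ((F.refine d).P 0) 0 (Matrix.specialUnitaryGroup (Fin 2) ℂ)) ≤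
            Real.exp (ρ K) *
            ((∫ u in {u | θBal F.L (γ * ((F.L : ℝ)⁻¹) ^ d) b₀ p₀ 0 ≤ GaugeGroup.dist1 (GaugeField.plaqHol u q)},
                resUnitDensity (F.refine d) (γ * ((F.L : ℝ)⁻¹) ^ d) K
                  (histGood (F.refine d) ℰp (θBal F.L (γ * ((F.L : ℝ)⁻¹) ^ d) b₀ p₀) K 1) u
                ∂fieldMeasure ((F.refine d).P 0) 0 (Matrix.specialUnitaryGroup (Fin 2) ℂ)) /
              (∫ u, resUnitDensity (F.refine d) (γ * ((F.L : ℝ)⁻¹) ^ d) K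
                  (histGood (F.refine d) ℰp (θBal F.L (γ * ((F.L : ℝ)⁻¹) ^ d) b₀ p₀) K 1) u
                ∂fieldMeasure ((F.refine d).P 0) 0 (Matrix.specialUnitaryGroup (Fin 2) ℂ)))) :
    Summit.QuantumFields.YangMills.Theses.SmallFieldWidening.LargeFieldMassRefinementTail := by
  refine largeFieldMassRefinementTail_of_condStabFam fun L => ?_
  obtain ⟨b₀, p₀, hb₀, hp₀, h⟩ := hDS L
  refine ⟨b₀, p₀, hb₀, hp₀, fun F γ hFL hγ => ?_⟩
  obtain ⟨n₁, R, hgrowth, hstep⟩ := h F γ hFL hγ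
  refine ⟨n₁, R, hgrowth, fun d hd q => ?_⟩
  obtain ⟨ρ, hρ, hchain⟩ := hstep d hd q
  refine ⟨ρ, hρ, fun K hK => ?_⟩
  have hγd : 0 ≤ γ * ((F.L : ℝ)⁻¹) ^ d :=
    mul_nonneg hγ.le (pow_nonneg (inv_nonneg.mpr (by exact_mod_cast (zero_lt_one.trans F.hL.2).le)) d)
  have h1 := cond_unitTop_eq_densityRatio (F.refine d) (K + 1) hγd (θBal F.L (γ * ((F.L : ℝ)⁻¹) ^ d) b₀ p₀)
    (θBal F.L (γ * ((F.L : ℝ)⁻¹) ^ d) b₀ p₀ 0) (plaqShift ((F.refine d).sitesPerDir_unit (K + 1)) q)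
  have h2 := cond_unitTop_eq_densityRatio (F.refine d) K hγd (θBal F.L (γ * ((F.L : ℝ)⁻¹) ^ d) b₀ p₀)
    (θBal F.L (γ * ((F.L : ℝ)⁻¹) ^ d) b₀ p₀ 0) (plaqShift ((F.refine d).sitesPerDir_unit K) q)
  rw [Equiv.symm_apply_apply] at h1 h2
  rw [h1, h2]
  exact hchain K hK

end Step

end Summit.QuantumFields.YangMills.Theorems.LargeFieldMassRefinementTailCondStabDensity

end
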